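/-
Copyright: the b2b-balaban T⁴-continuum CRUX team, row NE7b OWNER lineage `t4-ne7b-p1` (gen 127). Project licence.
-/
import Summits.QuantumFields.BalabanUV.T4Continuum.Spine.NE7b.SupConvexStepGaussianExact
import Literature.MathematicalPhysics.QuantumFieldTheory.BalabanImbrieJaffe1984to88.BIJ88CondMoments305

/-!
# THE GAUSSIAN FLUCTUATION MEASURE'S COVARIANCE IS THE FLUCTUATION COVARIANCE: on a finite carrier `ι`, for a symmetric form `H`
# with a floor and a chart `P : ℝ^σ → ℝ^ι` of the fibre, the density `e^{−½H(Pz)(Pz)}dz` of (121)'s fibre integral has, read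
# through `P`, mean ZERO and second moments `∫ (Pz)_x(Pz)_y e^{−½H(Pz)(Pz)}dz = C(x,y)·∫ e^{−½H(Pz)(Pz)}dz` with
# `C = P(PᵀHP)⁻¹Pᵀ` — and `C` is CHART-FREE: `Cf` is the UNIQUE field of the fibre whose `H`-pairing with the fibre reproduces `f`
# (the fluctuation-covariance operator of (101)∕(61) §8 read on the fibre `range P = ker Q′t`); the first typed object of the
# cluster-expansion step (d1) of § [NE7bP1-G126-HANDOFF] (row NE7b, node U5c; (121) + the tree's `gaussProb` moments BY NAME; [folklore])

Cell `pub-balaban`, sub-cell `t4`, spine estimate NE7b (`T4WeightBudget.RelWeightBound`; the cell's OWN estimate — NOT PRINTED in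
[Bałaban 1983–89], NOT PROVED).  Crux-route work under `Spine/NE7b/` by the row OWNER (`t4-ne7b-p1` gen 127, file (271)) under FREEZE
(0)'s crux-prover clause, on § [NE7bP1-G126-HANDOFF] NEXT (3)(d) ∕ `g126/records/SCOPING-d-cluster.md` (d1) («the Gaussian measure on
`ker Q′` … moments = `C_k` entries»), at TEA's level (finite carriers; the torus instance is one `obtain` on (123)'s chart); NOTHING of
Bałaban's is named as a Lean object, valued or asserted; no `T4Continuum/Support` leaf typed; no `def`, no notation (the chart precision
matrix `M_z(j,k) = H(Pe_j)(Pe_k)` is ANY matrix with that displayed clause); zero `sorry`.  Imports (BY NAME): the OWNER's (121)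
`…SupConvexStepGaussianExact` (`formIntegral_pos`); the tree's `Literature/…/BalabanImbrieJaffe1984to88/BIJ88CondMoments305`
(`integral_mul_apply_gaussProb`, `integral_apply_gaussProb`, `integrable_(mul_)apply_gaussProb` — the first and second moments of
`B2Eq228Conditioning.gaussProb M = e^{−½⟨z,Mz⟩}dz∕Z`, via Mathlib's `multivariateGaussian`), `B2Eq228Conditioning`
(`integral_gaussProb_eq`, `gaussNorm_pos`), `B13GaugeDevices` (`gaussWeight`, `gaussNorm`); Mathlib's `Matrix.PosDef.of_dotProduct_mulVec_pos`,
`Matrix.mul_nonsing_inv`, `Matrix.transpose_nonsing_inv`.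

WHY (located).  The road's one-step objects are in place ((123): chart `P` onto `ker Q′t`, background `Φ`, the integrated action `W_int`
with its Laplace sandwich; (121): for a quadratic action the fibre integral IS `e^{−S(Φw)}·∫ e^{−½H(Pz)(Pz)}dz`), and on `ℤ^d` the
fluctuation covariance `C_K` has decay, positivity and an `ℓ²` bound ((221)∕(257)∕(265)).  The cluster-expansion step needs the MEASURE
whose covariance that operator is: the normalised density `e^{−½H(Pz)(Pz)}dz` in chart coordinates is the tree's `gaussProb M_z`
(`M_z = PᵀHP` positive definite by the floor and the chart bound), its moments are `M_z⁻¹` by name, and pushing forward through `P` gives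
`C = PM_z⁻¹Pᵀ`; that `C` does not depend on the chart is the uniqueness of the fibre solution ((101)'s argument for a bilinear `H`), so
every later file may quote `C` by its two displayed clauses (in the fibre; fibre equation) and never by a chart.

WHAT IS PROVED ([folklore]; `ι` finite, `σ` finite, `H : ℝ^ι →L ℝ^ι →L ℝ`, `P : ℝ^σ →L ℝ^ι`, `M_z` with `M_z(j,k) = H(Pe_j)(Pe_k)`):
* §1 `chart_expand`, `chart_apply` (`Pz = Σ_j z_j Pe_j`), **`form_chart_eq`** (`H(Pz)(Pz′) = zᵀM_zz′`), `chart_transpose_eq` (`H`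
  symmetric ⟹ `M_zᵀ = M_z`), **`chart_posDef`** (floor `m > 0` + chart bound `p > 0` ⟹ `M_z` positive definite).
* §2 `gaussWeight_chart`, `formIntegral_eq_gaussNorm` (the density IS `gaussWeight M_z`, the fibre integral IS `gaussNorm M_z`),
  **`fibre_first_moment`** (`∫ (Pz)_x e^{−½H(Pz)(Pz)}dz = 0`), **`fibre_second_moment`**
  (`∫ (Pz)_x(Pz)_y e^{−½H(Pz)(Pz)}dz = (PM_z⁻¹Pᵀ)(x,y)·∫ e^{−½H(Pz)(Pz)}dz`).
* §3 `covariance_mem_fibre` (`PM_z⁻¹Pᵀf = P(M_z⁻¹Pᵀf)` lies in the fibre), **`covariance_fibre_equation`**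
  (`H(PM_z⁻¹Pᵀf)(Pζ) = Σ f·Pζ` for every `ζ`), **`fibre_solution_unique`** (two fibre fields with the same `H`-pairing against the fibre
  are equal — floor), `covariance_symm`.
* §4 THE END **`fibre_gaussian_covariance`** (`∃ C` symmetric: `Cf` in the fibre with the fibre equation, uniqueness of such fields,
  `Z > 0`, mean zero, second moments `C(x,y)·Z`) and **`fibre_gaussian_pairing`** (`∫ ⟨f,Pz⟩⟨g,Pz⟩e^{−½H(Pz)(Pz)}dz = ⟨f,Cg⟩·Z`); §5 toy.

HONEST (what this is NOT).  Finite-dimensional Gaussian calculus by name — no estimate; the torus instance ((123)'s `P`, the road's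
Hessian) and the identification with (169)'s block-`ℓ²` objects are the successor's `obtain`; no higher moments ∕ Wick's theorem beyond
order two (the tree's `multivariateGaussian` API carries them when wanted); nothing of the non-Gaussian fluctuation measure
`e^{−S(Mw + Pz)}dz`; scalar skeleton ((A3), NC-NE7b-α UNRULED); nothing of Bałaban's asserted.  BY-NAME EFFECT ON THE WALL: NONE.  NE7b NOT
PRINTED ∕ NOT PROVED; spine PROVED 0∕9; rung (B)+1 — the programme's measures remain FINITE-torus statements; NOT the mass gap, NOT Clay.
HONEST DEPENDENCY: continuum YM on T⁴ ⇐ BetaPertH ∧ nine spine estimates (0∕9 proved); BetaPertH ⇐ (D1) ∧ (D4) ∧ CAP+tail; G-an2-4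
gates asym, D1 and NE2∕3∕4.
-/

set_option autoImplicit false

noncomputable section

namespace Summit.QuantumFields.BalabanUV.T4Continuum.NE7b.SupFibreGaussianCovariance

open MeasureTheory Real Matrix
open Literature.MathematicalPhysics.QuantumFieldTheory.Balaban1983to89
open B13GaugeDevices (gaussWeight gaussNorm)
open B2Eq228Conditioning (gaussProb integral_gaussProb_eq gaussNorm_pos)
open Literature.MathematicalPhysics.QuantumFieldTheory.BalabanImbrieJaffe1984to88.BIJ88CondMoments305
  (integral_mul_apply_gaussProb integral_apply_gaussProb integrable_mul_apply_gaussProb integrable_apply_gaussProb)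
open SupConvexStepGaussianExact (formIntegral_pos)

variable {ι : Type*} [Fintype ι] {σ : Type} [Fintype σ] [DecidableEq σ]
  {H : (ι → ℝ) →L[ℝ] (ι → ℝ) →L[ℝ] ℝ} {m p : ℝ} (P : (σ → ℝ) →L[ℝ] (ι → ℝ))

/-! ## §1. The chart precision matrix -/

omit [Fintype ι] in
/-- **CHART EXPANSION**: `Pz = Σ_j z_j·Pe_j`. [folklore] -/
theorem chart_expand (z : σ → ℝ) : P z = ∑ j, z j • P (Pi.single j 1) := by
  conv_lhs => rw [← Finset.univ_sum_single z]
  rw [map_sum]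
  refine Finset.sum_congr rfl fun j _ => ?_
  rw [← map_smul]
  congr 1
  ext k
  by_cases h : k = j
  · subst h; simp
  · simp [h]

omit [Fintype ι] in
/-- `(Pz)_x = Σ_j z_j·(Pe_j)_x`. [folklore] -/
theorem chart_apply (z : σ → ℝ) (x : ι) : P z x = ∑ j, z j * P (Pi.single j 1) x := by
  rw [chart_expand P z, Finset.sum_apply]
  simp only [Pi.smul_apply, smul_eq_mul]

omit [Fintype ι] in
/-- **THE FORM IN THE CHART**: `M_z(j,k) = H(Pe_j)(Pe_k)` ⟹ `H(Pz)(Pz′) = zᵀM_zz′`. [folklore] -/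
theorem form_chart_eq (Mz : Matrix σ σ ℝ) (hMz : ∀ j k, Mz j k = H (P (Pi.single j 1)) (P (Pi.single k 1)))
    (z z' : σ → ℝ) : H (P z) (P z') = z ⬝ᵥ Mz *ᵥ z' := by
  have hL : ∀ j, H (P (Pi.single j 1)) (P z') = ∑ k, Mz j k * z' k := fun j => by
    rw [chart_expand P z', map_sum]
    exact Finset.sum_congr rfl fun k _ => by rw [map_smul, smul_eq_mul, hMz, mul_comm]
  rw [chart_expand P z, map_sum, _root_.sum_apply]
  simp only [map_smul, _root_.smul_apply, smul_eq_mul, hL]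
  simp only [dotProduct, mulVec]

omit [Fintype ι] [Fintype σ] in
/-- `H` symmetric ⟹ `M_zᵀ = M_z`. [folklore] -/
theorem chart_transpose_eq (hHsym : ∀ h k : ι → ℝ, H h k = H k h) (Mz : Matrix σ σ ℝ)
    (hMz : ∀ j k, Mz j k = H (P (Pi.single j 1)) (P (Pi.single k 1))) : Mzᵀ = Mz :=
  Matrix.ext fun j k => by rw [transpose_apply, hMz, hMz, hHsym]

/-- **THE CHART PRECISION MATRIX IS POSITIVE DEFINITE**: `H` symmetric with floor `m·Σh² ≤ H h h`, `m > 0`, and chart bound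
`p·Σz² ≤ Σ(Pz)²`, `p > 0`. [folklore] -/
theorem chart_posDef (hHsym : ∀ h k : ι → ℝ, H h k = H k h) (hfl : ∀ h : ι → ℝ, m * ∑ x, h x ^ 2 ≤ H h h) (hm : 0 < m)
    (hP : ∀ z : σ → ℝ, p * ∑ i, z i ^ 2 ≤ ∑ x, P z x ^ 2) (hp : 0 < p) (Mz : Matrix σ σ ℝ)
    (hMz : ∀ j k, Mz j k = H (P (Pi.single j 1)) (P (Pi.single k 1))) : Mz.PosDef := by
  refine Matrix.PosDef.of_dotProduct_mulVec_pos (Matrix.IsHermitian.ext fun j k => ?_) fun z hz => ?_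
  · rw [star_trivial, hMz, hMz, hHsym]
  · rw [star_trivial, ← form_chart_eq P Mz hMz z z]
    have hz2 : 0 < ∑ i, z i ^ 2 := by
      obtain ⟨i, hi⟩ : ∃ i, z i ≠ 0 := by
        by_contra h
        push Not at h
        exact hz (funext h)
      exact lt_of_lt_of_le (by positivity) (Finset.single_le_sum (fun j _ => sq_nonneg (z j)) (Finset.mem_univ i))
    have h1 := hfl (P z)
    have h2 := hP z
    nlinarith [mul_le_mul_of_nonneg_left h2 hm.le, mul_pos (mul_pos hm hp) hz2]

/-! ## §2. The density is `gaussWeight M_z`; first and second moments -/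

omit [Fintype ι] in
/-- The Gaussian fluctuation density in the chart IS the tree's `gaussWeight M_z`. [folklore] -/
theorem gaussWeight_chart (Mz : Matrix σ σ ℝ) (hMz : ∀ j k, Mz j k = H (P (Pi.single j 1)) (P (Pi.single k 1)))
    (z : σ → ℝ) : exp (-((1 / 2 : ℝ) * H (P z) (P z))) = gaussWeight Mz z := by
  rw [form_chart_eq P Mz hMz]
  rfl

omit [Fintype ι] in
/-- The Gaussian fluctuation integral IS the tree's `gaussNorm M_z`. [folklore] -/
theorem formIntegral_eq_gaussNorm (Mz : Matrix σ σ ℝ) (hMz : ∀ j k, Mz j k = H (P (Pi.single j 1)) (P (Pi.single k 1))) :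
    ∫ z : σ → ℝ, exp (-((1 / 2 : ℝ) * H (P z) (P z))) = gaussNorm Mz := by
  simp_rw [gaussWeight_chart P Mz hMz]
  rfl

/-- **MEAN ZERO**: `∫ (Pz)_x e^{−½H(Pz)(Pz)}dz = 0`. [folklore] -/
theorem fibre_first_moment (hHsym : ∀ h k : ι → ℝ, H h k = H k h) (hfl : ∀ h : ι → ℝ, m * ∑ x, h x ^ 2 ≤ H h h) (hm : 0 < m)
    (hP : ∀ z : σ → ℝ, p * ∑ i, z i ^ 2 ≤ ∑ x, P z x ^ 2) (hp : 0 < p) (Mz : Matrix σ σ ℝ)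
    (hMz : ∀ j k, Mz j k = H (P (Pi.single j 1)) (P (Pi.single k 1))) (x : ι) :
    ∫ z : σ → ℝ, P z x * exp (-((1 / 2 : ℝ) * H (P z) (P z))) = 0 := by
  have hpd := chart_posDef P hHsym hfl hm hP hp Mz hMz
  have hN : 0 < gaussNorm Mz := gaussNorm_pos hpd
  have hρ : ∀ z : σ → ℝ, P z x * exp (-((1 / 2 : ℝ) * H (P z) (P z))) = gaussWeight Mz z * P z x := fun z => by
    rw [gaussWeight_chart P Mz hMz, mul_comm]
  simp_rw [hρ]
  have hI : ∫ z, gaussWeight Mz z * P z x = gaussNorm Mz * ∫ z, P z x ∂(gaussProb Mz) := by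
    rw [integral_gaussProb_eq Mz (fun z => P z x), mul_inv_cancel_left₀ hN.ne']
  rw [hI, show (fun z : σ → ℝ => P z x) = fun z => ∑ j, P (Pi.single j 1) x * z j from
    funext fun z => by rw [chart_apply P z x]; exact Finset.sum_congr rfl fun j _ => mul_comm _ _]
  rw [integral_finsetSum _ (fun j _ => (integrable_apply_gaussProb hpd j).const_mul _)]
  simp_rw [integral_const_mul, integral_apply_gaussProb hpd, mul_zero, Finset.sum_const_zero, mul_zero]

/-- **SECOND MOMENTS**: `∫ (Pz)_x(Pz)_y e^{−½H(Pz)(Pz)}dz = (Σ_{j,k}(Pe_j)_x(M_z⁻¹)_{jk}(Pe_k)_y)·∫ e^{−½H(Pz)(Pz)}dz`. [folklore] -/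
theorem fibre_second_moment (hHsym : ∀ h k : ι → ℝ, H h k = H k h) (hfl : ∀ h : ι → ℝ, m * ∑ x, h x ^ 2 ≤ H h h) (hm : 0 < m)
    (hP : ∀ z : σ → ℝ, p * ∑ i, z i ^ 2 ≤ ∑ x, P z x ^ 2) (hp : 0 < p) (Mz : Matrix σ σ ℝ)
    (hMz : ∀ j k, Mz j k = H (P (Pi.single j 1)) (P (Pi.single k 1))) (x y : ι) :
    ∫ z : σ → ℝ, P z x * P z y * exp (-((1 / 2 : ℝ) * H (P z) (P z)))
      = (∑ j, ∑ k, P (Pi.single j 1) x * Mz⁻¹ j k * P (Pi.single k 1) y)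
        * ∫ z : σ → ℝ, exp (-((1 / 2 : ℝ) * H (P z) (P z))) := by
  have hpd := chart_posDef P hHsym hfl hm hP hp Mz hMz
  have hN : 0 < gaussNorm Mz := gaussNorm_pos hpd
  have hρ : ∀ z : σ → ℝ, P z x * P z y * exp (-((1 / 2 : ℝ) * H (P z) (P z))) = gaussWeight Mz z * (P z x * P z y) :=
    fun z => by rw [gaussWeight_chart P Mz hMz]; ring
  simp_rw [hρ]
  rw [formIntegral_eq_gaussNorm P Mz hMz]
  have hI : ∫ z, gaussWeight Mz z * (P z x * P z y) = gaussNorm Mz * ∫ z, P z x * P z y ∂(gaussProb Mz) := by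
    rw [integral_gaussProb_eq Mz (fun z => P z x * P z y), mul_inv_cancel_left₀ hN.ne']
  rw [hI, mul_comm]
  congr 1
  rw [show (fun z : σ → ℝ => P z x * P z y)
      = fun z => ∑ j, ∑ k, P (Pi.single j 1) x * P (Pi.single k 1) y * (z j * z k) from funext fun z => by
    rw [chart_apply P z x, chart_apply P z y, Finset.sum_mul_sum]
    exact Finset.sum_congr rfl fun j _ => Finset.sum_congr rfl fun k _ => by ring]
  rw [integral_finsetSum _ (fun j _ => integrable_finsetSum _ fun k _ => (integrable_mul_apply_gaussProb hpd j k).const_mul _)]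
  refine Finset.sum_congr rfl fun j _ => ?_
  rw [integral_finsetSum _ (fun k _ => (integrable_mul_apply_gaussProb hpd j k).const_mul _)]
  exact Finset.sum_congr rfl fun k _ => by rw [integral_const_mul, integral_mul_apply_gaussProb hpd]; ring

/-! ## §3. `PM_z⁻¹Pᵀ` is the fibre solution operator — chart-free -/

omit [Fintype ι] in
/-- Finite triple sums commute (the reindexing used twice below). -/
private theorem sum_sum_sum_comm {α β γ : Type*} [Fintype α] [Fintype β] [Fintype γ] (F : α → β → γ → ℝ) :
    ∑ a, ∑ b, ∑ c, F a b c = ∑ c, ∑ a, ∑ b, F a b c := by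
  have h1 : ∀ a, ∑ b, ∑ c, F a b c = ∑ c, ∑ b, F a b c := fun a => Finset.sum_comm
  simp_rw [h1]
  exact Finset.sum_comm

/-- **`PM_z⁻¹Pᵀf` LIES IN THE FIBRE**: it is `P` of the chart vector `M_z⁻¹(Pᵀf)`. [folklore] -/
theorem covariance_mem_fibre (Mz : Matrix σ σ ℝ) (f : ι → ℝ) :
    P (Mz⁻¹ *ᵥ fun k => ∑ y, P (Pi.single k 1) y * f y)
      = fun x => ∑ y, (∑ j, ∑ k, P (Pi.single j 1) x * Mz⁻¹ j k * P (Pi.single k 1) y) * f y := by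
  ext x
  rw [chart_apply P]
  simp only [mulVec, dotProduct, Finset.sum_mul, Finset.mul_sum]
  -- both sides are `Σ_j Σ_k Σ_y (Pe_j)_x (M_z⁻¹)_{jk} (Pe_k)_y f_y`
  rw [show (∑ y, ∑ j, ∑ k, P (Pi.single j 1) x * Mz⁻¹ j k * P (Pi.single k 1) y * f y)
      = ∑ j, ∑ k, ∑ y, P (Pi.single j 1) x * Mz⁻¹ j k * P (Pi.single k 1) y * f y from
    (sum_sum_sum_comm (fun j k y => P (Pi.single j 1) x * Mz⁻¹ j k * P (Pi.single k 1) y * f y)).symm]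
  exact Finset.sum_congr rfl fun j _ => Finset.sum_congr rfl fun k _ => Finset.sum_congr rfl fun y _ => by ring

/-- **THE FIBRE EQUATION**: `H` symmetric with floor, chart bound ⟹ `H(PM_z⁻¹Pᵀf)(Pζ) = Σ_y f_y(Pζ)_y` for every `ζ` — the
`H`-pairing of `Cf` with the fibre reproduces `f`. [folklore] -/
theorem covariance_fibre_equation (hHsym : ∀ h k : ι → ℝ, H h k = H k h) (hfl : ∀ h : ι → ℝ, m * ∑ x, h x ^ 2 ≤ H h h)
    (hm : 0 < m) (hP : ∀ z : σ → ℝ, p * ∑ i, z i ^ 2 ≤ ∑ x, P z x ^ 2) (hp : 0 < p) (Mz : Matrix σ σ ℝ)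
    (hMz : ∀ j k, Mz j k = H (P (Pi.single j 1)) (P (Pi.single k 1))) (f : ι → ℝ) (ζ : σ → ℝ) :
    H (fun x => ∑ y, (∑ j, ∑ k, P (Pi.single j 1) x * Mz⁻¹ j k * P (Pi.single k 1) y) * f y) (P ζ)
      = ∑ y, f y * P ζ y := by
  have hpd := chart_posDef P hHsym hfl hm hP hp Mz hMz
  have hdet : IsUnit Mz.det := isUnit_iff_ne_zero.2 hpd.det_pos.ne'
  have hT := chart_transpose_eq P hHsym Mz hMz
  rw [← covariance_mem_fibre P Mz f, form_chart_eq P Mz hMz, dotProduct_mulVec, ← mulVec_transpose, hT, mulVec_mulVec,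
    mul_nonsing_inv _ hdet, one_mulVec]
  rw [show (∑ y, f y * P ζ y) = ∑ y, f y * ∑ k, ζ k * P (Pi.single k 1) y from
    Finset.sum_congr rfl fun y _ => by rw [chart_apply P ζ y]]
  simp only [dotProduct, Finset.sum_mul, Finset.mul_sum]
  rw [Finset.sum_comm]
  exact Finset.sum_congr rfl fun y _ => Finset.sum_congr rfl fun k _ => by ring

omit [Fintype σ] [DecidableEq σ] in
/-- **UNIQUENESS OF THE FIBRE SOLUTION** (bilinear form with a floor): two fields of the fibre with the same `H`-pairing against every
field of the fibre are equal. [folklore] -/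
theorem fibre_solution_unique (hfl : ∀ h : ι → ℝ, m * ∑ x, h x ^ 2 ≤ H h h) (hm : 0 < m) {u u' : ι → ℝ}
    (hu : ∃ w : σ → ℝ, P w = u) (hu' : ∃ w' : σ → ℝ, P w' = u') (h : ∀ ζ : σ → ℝ, H u (P ζ) = H u' (P ζ)) : u = u' := by
  obtain ⟨w, rfl⟩ := hu
  obtain ⟨w', rfl⟩ := hu'
  have h0 : H (P w - P w') (P w - P w') = 0 := by
    rw [map_sub H, _root_.sub_apply, ← map_sub P, h (w - w'), sub_self]
  have h1 := hfl (P w - P w')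
  rw [h0] at h1
  have hsq : ∑ x, (P w - P w') x ^ 2 = 0 :=
    le_antisymm (by nlinarith [Finset.sum_nonneg fun x (_ : x ∈ Finset.univ) => sq_nonneg ((P w - P w') x)])
      (Finset.sum_nonneg fun x _ => sq_nonneg _)
  funext x
  have hx := (Finset.sum_eq_zero_iff_of_nonneg fun x' _ => sq_nonneg ((P w - P w') x')).1 hsq x (Finset.mem_univ x)
  exact sub_eq_zero.1 ((pow_eq_zero_iff two_ne_zero).1 hx)

omit [Fintype ι] in
/-- `PM_z⁻¹Pᵀ` is symmetric (`H` symmetric). [folklore] -/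
theorem covariance_symm (hHsym : ∀ h k : ι → ℝ, H h k = H k h) (Mz : Matrix σ σ ℝ)
    (hMz : ∀ j k, Mz j k = H (P (Pi.single j 1)) (P (Pi.single k 1))) (x y : ι) :
    ∑ j, ∑ k, P (Pi.single j 1) x * Mz⁻¹ j k * P (Pi.single k 1) y
      = ∑ j, ∑ k, P (Pi.single j 1) y * Mz⁻¹ j k * P (Pi.single k 1) x := by
  have hT := chart_transpose_eq P hHsym Mz hMz
  have hTi : ∀ j k, Mz⁻¹ k j = Mz⁻¹ j k := fun j k => by
    have e : (Mz⁻¹)ᵀ = Mz⁻¹ := by rw [transpose_nonsing_inv, hT]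
    rw [← transpose_apply (Mz⁻¹) j k, e]
  rw [Finset.sum_comm]
  exact Finset.sum_congr rfl fun k _ => Finset.sum_congr rfl fun j _ => by rw [hTi j k]; ring

/-! ## §4. THE END -/

/-- **HEADLINE — THE GAUSSIAN FLUCTUATION MEASURE'S COVARIANCE IS THE FLUCTUATION COVARIANCE.**  Finite carrier `ι`, chart `P : ℝ^σ → ℝ^ι`
with `p·Σz² ≤ Σ(Pz)²` (`p > 0`), form `H` symmetric with floor `m·Σh² ≤ H h h` (`m > 0`) ⟹ `∃ C` symmetric with: (fibre) every `Cf` is a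
field of the fibre `range P` whose `H`-pairing with the fibre reproduces `f`; (uniqueness) it is the ONLY such field — `C` is chart-free;
(measure) `Z = ∫ e^{−½H(Pz)(Pz)}dz > 0`, `∫ (Pz)_x e^{−½H(Pz)(Pz)}dz = 0`, `∫ (Pz)_x(Pz)_y e^{−½H(Pz)(Pz)}dz = C(x,y)·Z`. [folklore] -/
theorem fibre_gaussian_covariance (hHsym : ∀ h k : ι → ℝ, H h k = H k h) (hfl : ∀ h : ι → ℝ, m * ∑ x, h x ^ 2 ≤ H h h)
    (hm : 0 < m) (hP : ∀ z : σ → ℝ, p * ∑ i, z i ^ 2 ≤ ∑ x, P z x ^ 2) (hp : 0 < p) :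
    ∃ C : ι → ι → ℝ,
      (∀ x y, C x y = C y x) ∧
      (∀ f : ι → ℝ, (∃ w : σ → ℝ, P w = fun x => ∑ y, C x y * f y) ∧
        ∀ ζ : σ → ℝ, H (fun x => ∑ y, C x y * f y) (P ζ) = ∑ y, f y * P ζ y) ∧
      (∀ (f u : ι → ℝ), (∃ w : σ → ℝ, P w = u) → (∀ ζ : σ → ℝ, H u (P ζ) = ∑ y, f y * P ζ y) →
        u = fun x => ∑ y, C x y * f y) ∧
      0 < ∫ z : σ → ℝ, exp (-((1 / 2 : ℝ) * H (P z) (P z))) ∧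
      (∀ x, ∫ z : σ → ℝ, P z x * exp (-((1 / 2 : ℝ) * H (P z) (P z))) = 0) ∧
      (∀ x y, ∫ z : σ → ℝ, P z x * P z y * exp (-((1 / 2 : ℝ) * H (P z) (P z)))
        = C x y * ∫ z : σ → ℝ, exp (-((1 / 2 : ℝ) * H (P z) (P z)))) := by
  classical
  obtain ⟨Mz, hMz⟩ : ∃ Mz : Matrix σ σ ℝ, ∀ j k, Mz j k = H (P (Pi.single j 1)) (P (Pi.single k 1)) :=
    ⟨Matrix.of fun j k => H (P (Pi.single j 1)) (P (Pi.single k 1)), fun _ _ => rfl⟩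
  refine ⟨fun x y => ∑ j, ∑ k, P (Pi.single j 1) x * Mz⁻¹ j k * P (Pi.single k 1) y,
    fun x y => covariance_symm P hHsym Mz hMz x y,
    fun f => ⟨⟨_, covariance_mem_fibre P Mz f⟩, fun ζ => covariance_fibre_equation P hHsym hfl hm hP hp Mz hMz f ζ⟩,
    fun f u hu hfib => ?_, formIntegral_pos P hfl hm hP hp, fun x => fibre_first_moment P hHsym hfl hm hP hp Mz hMz x,
    fun x y => fibre_second_moment P hHsym hfl hm hP hp Mz hMz x y⟩
  exact fibre_solution_unique P hfl hm hu ⟨_, covariance_mem_fibre P Mz f⟩ fun ζ => by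
    rw [hfib ζ, covariance_fibre_equation P hHsym hfl hm hP hp Mz hMz f ζ]

omit [DecidableEq σ] in
/-- **THE PAIRING FORM**: for the `C` of the headline (or any `C` with its second-moment clause) and all `f, g`,
`∫ ⟨f,Pz⟩⟨g,Pz⟩e^{−½H(Pz)(Pz)}dz = (Σ_{x,y} f_x C(x,y) g_y)·∫ e^{−½H(Pz)(Pz)}dz`. [folklore] -/
theorem fibre_gaussian_pairing (C : ι → ι → ℝ)
    (hint : ∀ x y, Integrable fun z : σ → ℝ => P z x * P z y * exp (-((1 / 2 : ℝ) * H (P z) (P z))))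
    (hC : ∀ x y, ∫ z : σ → ℝ, P z x * P z y * exp (-((1 / 2 : ℝ) * H (P z) (P z)))
      = C x y * ∫ z : σ → ℝ, exp (-((1 / 2 : ℝ) * H (P z) (P z)))) (f g : ι → ℝ) :
    ∫ z : σ → ℝ, (∑ x, f x * P z x) * (∑ y, g y * P z y) * exp (-((1 / 2 : ℝ) * H (P z) (P z)))
      = (∑ x, ∑ y, f x * C x y * g y) * ∫ z : σ → ℝ, exp (-((1 / 2 : ℝ) * H (P z) (P z))) := by
  have hprod : ∀ z : σ → ℝ, (∑ x, f x * P z x) * (∑ y, g y * P z y) * exp (-((1 / 2 : ℝ) * H (P z) (P z)))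
      = ∑ x, ∑ y, f x * g y * (P z x * P z y * exp (-((1 / 2 : ℝ) * H (P z) (P z)))) := by
    intro z
    rw [Finset.sum_mul_sum, Finset.sum_mul]
    exact Finset.sum_congr rfl fun x _ => by
      rw [Finset.sum_mul]
      exact Finset.sum_congr rfl fun y _ => by ring
  simp_rw [hprod]
  rw [integral_finsetSum _ (fun x _ => integrable_finsetSum _ fun y _ => (hint x y).const_mul _), Finset.sum_mul]
  refine Finset.sum_congr rfl fun x _ => ?_
  rw [integral_finsetSum _ (fun y _ => (hint x y).const_mul _), Finset.sum_mul]
  exact Finset.sum_congr rfl fun y _ => by rw [integral_const_mul, hC]; ring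

/-! ## §5. Toy -/

/-- Toy (`ι = σ = Fin 1`, `P = id`, `H h k = h 0·k 0`): the headline's constant exists. -/
example : ∃ C : Fin 1 → Fin 1 → ℝ, ∀ x y, C x y = C y x := by
  obtain ⟨H, hH⟩ : ∃ H : (Fin 1 → ℝ) →L[ℝ] (Fin 1 → ℝ) →L[ℝ] ℝ, ∀ h k, H h k = h 0 * k 0 :=
    ⟨((ContinuousLinearMap.mul ℝ ℝ).comp (ContinuousLinearMap.proj 0)).flip.comp (ContinuousLinearMap.proj 0) |>.flip,
      fun h k => by simp⟩
  have hsum : ∀ h : Fin 1 → ℝ, ∑ x, h x ^ 2 = h 0 ^ 2 := fun h => by simp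
  obtain ⟨C, hC, -⟩ := fibre_gaussian_covariance (ContinuousLinearMap.id ℝ (Fin 1 → ℝ)) (m := 1) (p := 1)
    (fun h k => by rw [hH, hH, mul_comm]) (fun h => by rw [hH, hsum]; nlinarith) one_pos
    (fun z => by simp) one_pos
  exact ⟨C, hC⟩

end Summit.QuantumFields.BalabanUV.T4Continuum.NE7b.SupFibreGaussianCovariance
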